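import Summits.QuantumFields.YangMills.Theorems.UnitScaleTiltHistoryTailBoundedHeightLocal
import Summits.QuantumFields.YangMills.Theorems.SmallFieldWideningPlainStabAddOfLocalStepFloor

/-!
# Route `SmallFieldWidening`, crux r3 `LargeFieldMassRefinementTail` (stmt-QuantumFields-22884) and child crux r4 `PlainStabAdd`
# (stmt-QuantumFields-27718), line `birth` — support file: THE (base) CONJUNCT OF THE INTERFACE OF RECORD `LocalStepFloor` IS FREE AT ANY
# STARTING RUN `k₀` FIXED BEFORE THE PRECISION — `StepOnlyFrom ⇒ LocalStepFloor ⇒ PlainStabAdd ⇒ LargeFieldMassRefinementTail`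

Width seat `ym-line-sfw-p2-w2` (gen 47).  WHAT.  The registered stub `stub_localStepFloor` (skeleton v9 of `Cruxes/LargeFieldMassRefinementTail/Lines/birth.lean`;
= hypothesis `hLS` of `PlainStabAddOfLocalStepFloor.largeFieldMassRefinementTail_of_localStepFloor`) asks for a base rate `c_b` fixed BEFORE the
precision `η`, then for every `η` a starting run `k₀`, a (base) tail of the `k₀`-fold averaged unit plaquette at run `k₀`
(`≤ C_b γ^{−N_b} e^{−c_b p(√γ)²}`), an interval-summable slack, a polynomial guard and the one-step comparison (step) for `K ≥ k₀`.
The tree ALREADY proves the (base) tail at every BOUNDED height with VOLUME-UNIFORM constants: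
`HistoryTailBoundedHeightLocal.perPlaquette_boundedHeight_uniform L j₀` (cell ym3-torus, crux `HistoryTailL`; local crude Prop 1 iterated +
the chessboard single-plaquette tail) — read at `K = j = k₀` it is exactly the (base) conjunct, for every threshold multiplier `t ∈ [1/2,1]`
(`t·θ_{b₀} = θ_{t b₀}`, `p_{t b₀} = t·p_{b₀}`: the profile is linear in `b₀`), with `c_b = c(L,k₀)/4`, `N_b = 5`, `C_b = C(L,k₀)`.
Hence ★★ `localStepFloor_of_stepOnlyFrom`: the stub follows from `StepOnlyFrom` = «∃ k₀ ≥ 1 and b′ > 0 (fixed with `L, b₀, p₀`, BEFORE `η`) such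
that for every `η > 0`: (slack from `k₀`) ∧ (card from `k₀`) ∧ (step for `K ≥ k₀`)» — the formula spelled out as the hypothesis, no definition
introduced; ★ `plainStabAdd_of_stepOnlyFrom`, ★ `largeFieldMassRefinementTail_of_stepOnlyFrom`: cruxes r4 / r3 BY NAME (conditional certificates).
So a lead may RESHAPE the line's one stub to `StepOnlyFrom` (the (base) conjunct and the letters `c_b, C_b, N_b` removed; `k₀` moved before `η`);
this file is the one-line closer of that reshape.  (The sibling file `…OfStepOnlyFirstRun` is the case `k₀ = 1`.)
WHAT THIS IS NOT.  `StepOnlyFrom` is NOT proved — it is the cutoff-uniform EVENT-level one-step small-field comparison, open in print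
([Balaban1985UV3] (70)–(71), [Balaban1987RG1] Thm 1, [Balaban1989LargeFieldII] §1 deliver densities, not event probabilities); the only
difference from the registered stub is that the supplier no longer owes the base tail and may not let `k₀` grow with `η`; cruxes 22884 / 27718
stay OPEN; rung R3 is a RECORD rung; the YM mass gap is NOT proved by any of this.
-/

noncomputable section

namespace Summit.QuantumFields.YangMills.Theorems.LargeFieldMassRefinementTailStepOnlyFrom

open MeasureTheory
open scoped BigOperators
open Literature.MathematicalPhysics.QuantumFieldTheory.Balaban1983to89
open Literature.MathematicalPhysics.QuantumFieldTheory.Balaban1983to89.T3ContinuumYM3Torus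
open Literature.MathematicalPhysics.QuantumFieldTheory.Balaban1983to89.T3UnitScaleTilt
open Literature.MathematicalPhysics.QuantumFieldTheory.Balaban1983to89.T3UnitLawDensityEML (ℰp)
open Literature.MathematicalPhysics.QuantumFieldTheory.Balaban1983to89.T3LevelShift
open Summit.QuantumFields.YangMills.Theorems.HistoryTailBoundedHeightLocal (perPlaquette_boundedHeight_uniform)
open Summit.QuantumFields.YangMills.Theorems.PlainStabAddOfLocalStepFloor
  (plainStabAdd_of_localStepFloor largeFieldMassRefinementTail_of_localStepFloor)

/-- Bałaban's thresholds are linear in the profile amplitude: `t·θ_{b₀}(i) = θ_{t b₀}(i)` (`p_{b}(g) = b(1 + log g⁻¹)^{p₀}`).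
[cite: Balaban1985UV3, (7) p.257] -/
theorem mul_θBal (L : ℕ) (γ b₀ p₀ t : ℝ) (i : ℕ) : t * θBal L γ b₀ p₀ i = θBal L γ (t * b₀) p₀ i := by
  simp only [θBal, B10.pFun]; ring

/-- ★ **THE (base) CONJUNCT OF `LocalStepFloor` AT ANY FIXED STARTING RUN**, from the tree's volume-uniform bounded-height tail
`perPlaquette_boundedHeight_uniform L k₀` read at `K = j = k₀` (`β_{K−j} = β₀ = γ⁻¹`, `g_{K−j} = √γ`): for every `L, k₀` and `b₀ > 0`, `p₀` there
are `c_b > 0`, `C_b ≥ 0` with `Gibbs_{k₀}{t·θ(0) ≤ |Ū^{k₀}(∂q) − 1|} ≤ C_b·γ^{−5}·exp(−c_b·p(√γ)²)` for every family with `F.L = L`, every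
`0 < γ ≤ 1`, every unit plaquette `q` and every `t ∈ [1/2, 1]` (`c_b = c(L,k₀)/4` absorbs `t² ≥ ¼`). [cite: Balaban1985UV3, (7) p.257 and (71) p.273] -/
theorem baseClause_at (L k₀ : ℕ) (b₀ p₀ : ℝ) (hb₀ : 0 < b₀) :
    ∃ (cb Cb : ℝ), 0 < cb ∧ 0 ≤ Cb ∧ ∀ (F : T3Family) (γ : ℝ), F.L = L → 0 < γ → γ ≤ 1 →
      ∀ (q : Plaq (F.P 0) 0) (t : ℝ), 1 / 2 ≤ t → t ≤ 1 →
        (gibbsK F ℰp γ k₀).real {U | t * θBal F.L γ b₀ p₀ 0 ≤ GaugeGroup.dist1 (GaugeField.plaqHol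
            (Averaging.iter (fun i => BlockAveraging.blockAvg (P := F.P k₀) (j := i) ℰp) k₀ U) (plaqShift (F.sitesPerDir_unit k₀) q))} ≤
          Cb * (γ⁻¹) ^ 5 * Real.exp (-(cb * B10.pFun b₀ p₀ (Real.sqrt γ) ^ 2)) := by
  obtain ⟨C, c, hC, hc, htail⟩ := perPlaquette_boundedHeight_uniform L k₀
  refine ⟨c / 4, C, by positivity, hC, fun F γ hF hγ hγ1 q t ht1 ht2 => ?_⟩
  have ht0 : 0 ≤ t := le_trans (by norm_num) ht1
  have h := htail F hF γ hγ hγ1 (t * b₀) (mul_nonneg ht0 hb₀.le) p₀ k₀ k₀ le_rfl le_rfl (plaqShift (F.sitesPerDir_unit k₀) q)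
  rw [Nat.sub_self, ← mul_θBal] at h
  refine h.trans ?_
  -- `β₀ = γ⁻¹`, `g₀ = √γ`, `p_{t b₀} = t·p_{b₀}`, `t² ≥ ¼`
  have hβ0 : (F.scheme ℰp γ).β 0 = γ⁻¹ := by
    rw [show (F.scheme ℰp γ).β 0 = (γ * ((F.L : ℝ)⁻¹) ^ 0)⁻¹ from rfl, pow_zero, mul_one]
  have hg0 : Real.sqrt (γ * ((F.L : ℝ)⁻¹) ^ 0) = Real.sqrt γ := by rw [pow_zero, mul_one]
  have hpt : B10.pFun (t * b₀) p₀ (Real.sqrt γ) = t * B10.pFun b₀ p₀ (Real.sqrt γ) := by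
    simp only [B10.pFun]; ring
  rw [hβ0, hg0, hpt]
  refine mul_le_mul_of_nonneg_left (Real.exp_le_exp.mpr ?_) (by positivity)
  rw [neg_le_neg_iff]
  have htt : (1 / 2 : ℝ) * (1 / 2) ≤ t * t := mul_le_mul ht1 ht1 (by norm_num) ht0
  have hp2 : 0 ≤ c * B10.pFun b₀ p₀ (Real.sqrt γ) ^ 2 := by positivity
  calc c / 4 * B10.pFun b₀ p₀ (Real.sqrt γ) ^ 2 = (c * B10.pFun b₀ p₀ (Real.sqrt γ) ^ 2) * ((1 / 2 : ℝ) * (1 / 2)) := by ring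
    _ ≤ (c * B10.pFun b₀ p₀ (Real.sqrt γ) ^ 2) * (t * t) := mul_le_mul_of_nonneg_left htt hp2
    _ = c * (t * B10.pFun b₀ p₀ (Real.sqrt γ)) ^ 2 := by ring

/-- ★★ **`LocalStepFloor` ⇐ `StepOnlyFrom`**: the interface of record with its (base) conjunct supplied by `baseClause_at` at the supplier's
starting run `k₀` (fixed with `L, b₀, p₀`, before the precision).  The hypothesis is (slack) ∧ (card) ∧ (step) from `k₀`, verbatim otherwise.
[cite: Balaban1985UV3, (7) p.257 and (70)-(71) p.273] -/
theorem localStepFloor_of_stepOnlyFrom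
    (hS : ∀ (L : ℕ) (b₀ p₀ : ℝ), 0 < b₀ → 2 < p₀ → ∃ (k₀ : ℕ) (b' : ℝ), 1 ≤ k₀ ∧ 0 < b' ∧ ∀ η : ℝ, 0 < η →
      ∃ (M : ℕ) (γ₁ A : ℝ), 0 < γ₁ ∧ γ₁ ≤ 1 ∧
      ∀ (F : T3Family) (γ : ℝ), F.L = L → 0 < γ → γ ≤ γ₁ →
        ∀ q : Plaq (F.P 0) 0, ∃ (ρ t : ℕ → ℝ) (S : (K : ℕ) → Finset (Plaq (F.P (K + 1)) 0)),
          (∀ K : ℕ, 1 / 2 ≤ t K ∧ t K ≤ 1) ∧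
          (∀ k K : ℕ, k₀ ≤ k → ∑ j ∈ Finset.Ico k K, ρ j ≤ A + η * B10.pFun b₀ p₀ (Real.sqrt γ) ^ 2) ∧
          (∀ K : ℕ, k₀ ≤ K → ((S K).card : ℝ) ≤ ((F.L : ℝ) ^ (K + 1)) ^ M) ∧
          ∀ K : ℕ, k₀ ≤ K →
            (gibbsK F ℰp γ (K + 1)).real ({U | t (K + 1) * θBal F.L γ b₀ p₀ 0 ≤ GaugeGroup.dist1 (GaugeField.plaqHol
                (Averaging.iter (fun i => BlockAveraging.blockAvg (P := F.P (K + 1)) (j := i) ℰp) (K + 1) U)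
                (plaqShift (F.sitesPerDir_unit (K + 1)) q))} ∩
              {U | PlaqSmallOn (↑(S K) : Set (Plaq (F.P (K + 1)) 0)) (θBal F.L γ b' p₀ (K + 1)) U}) ≤
            Real.exp (ρ K) *
            (gibbsK F ℰp γ K).real {U | t K * θBal F.L γ b₀ p₀ 0 ≤ GaugeGroup.dist1 (GaugeField.plaqHol
                (Averaging.iter (fun i => BlockAveraging.blockAvg (P := F.P K) (j := i) ℰp) K U)
                (plaqShift (F.sitesPerDir_unit K) q))}) :
    ∀ (L : ℕ) (b₀ p₀ : ℝ), 0 < b₀ → 2 < p₀ → ∃ (cb b' : ℝ), 0 < cb ∧ 0 < b' ∧ ∀ η : ℝ, 0 < η →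
      ∃ (k₀ Nb M : ℕ) (γ₁ Cb A : ℝ), 1 ≤ k₀ ∧ 0 < γ₁ ∧ γ₁ ≤ 1 ∧ 0 ≤ Cb ∧
      ∀ (F : T3Family) (γ : ℝ), F.L = L → 0 < γ → γ ≤ γ₁ →
        ∀ q : Plaq (F.P 0) 0, ∃ (ρ t : ℕ → ℝ) (S : (K : ℕ) → Finset (Plaq (F.P (K + 1)) 0)),
          (∀ K : ℕ, 1 / 2 ≤ t K ∧ t K ≤ 1) ∧
          (gibbsK F ℰp γ k₀).real {U | t k₀ * θBal F.L γ b₀ p₀ 0 ≤ GaugeGroup.dist1 (GaugeField.plaqHol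
                (Averaging.iter (fun i => BlockAveraging.blockAvg (P := F.P k₀) (j := i) ℰp) k₀ U) (plaqShift (F.sitesPerDir_unit k₀) q))} ≤
            Cb * (γ⁻¹) ^ Nb * Real.exp (-(cb * B10.pFun b₀ p₀ (Real.sqrt γ) ^ 2)) ∧
          (∀ k K : ℕ, k₀ ≤ k → ∑ j ∈ Finset.Ico k K, ρ j ≤ A + η * B10.pFun b₀ p₀ (Real.sqrt γ) ^ 2) ∧
          (∀ K : ℕ, k₀ ≤ K → ((S K).card : ℝ) ≤ ((F.L : ℝ) ^ (K + 1)) ^ M) ∧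
          ∀ K : ℕ, k₀ ≤ K →
            (gibbsK F ℰp γ (K + 1)).real ({U | t (K + 1) * θBal F.L γ b₀ p₀ 0 ≤ GaugeGroup.dist1 (GaugeField.plaqHol
                (Averaging.iter (fun i => BlockAveraging.blockAvg (P := F.P (K + 1)) (j := i) ℰp) (K + 1) U)
                (plaqShift (F.sitesPerDir_unit (K + 1)) q))} ∩
              {U | PlaqSmallOn (↑(S K) : Set (Plaq (F.P (K + 1)) 0)) (θBal F.L γ b' p₀ (K + 1)) U}) ≤
            Real.exp (ρ K) *
            (gibbsK F ℰp γ K).real {U | t K * θBal F.L γ b₀ p₀ 0 ≤ GaugeGroup.dist1 (GaugeField.plaqHol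
                (Averaging.iter (fun i => BlockAveraging.blockAvg (P := F.P K) (j := i) ℰp) K U)
                (plaqShift (F.sitesPerDir_unit K) q))} := by
  intro L b₀ p₀ hb₀ hp₀
  obtain ⟨k₀, b', hk₀, hb', hη⟩ := hS L b₀ p₀ hb₀ hp₀
  obtain ⟨cb, Cb, hcb, hCb, hbase⟩ := baseClause_at L k₀ b₀ p₀ hb₀
  refine ⟨cb, b', hcb, hb', fun η hηpos => ?_⟩
  obtain ⟨M, γ₁, A, hγ₁, hγ₁1, hstep⟩ := hη η hηpos
  refine ⟨k₀, 5, M, γ₁, Cb, A, hk₀, hγ₁, hγ₁1, hCb, fun F γ hF hγ hγγ₁ q => ?_⟩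
  obtain ⟨ρ, t, S, ht, hslack, hcard, hst⟩ := hstep F γ hF hγ hγγ₁ q
  exact ⟨ρ, t, S, ht, hbase F γ hF hγ (hγγ₁.trans hγ₁1) q (t k₀) (ht k₀).1 (ht k₀).2, hslack, hcard, hst⟩

/-- ★ **Crux r4 `PlainStabAdd` (stmt-QuantumFields-27718) BY NAME ⇐ `StepOnlyFrom`** (through `plainStabAdd_of_localStepFloor`).
Conditional certificate; the hypothesis is NOT proved. [cite: Balaban1985UV3, (70)-(71) p.273; Balaban1987RG1, Thm 1 p.259] -/
theorem plainStabAdd_of_stepOnlyFrom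
    (hS : ∀ (L : ℕ) (b₀ p₀ : ℝ), 0 < b₀ → 2 < p₀ → ∃ (k₀ : ℕ) (b' : ℝ), 1 ≤ k₀ ∧ 0 < b' ∧ ∀ η : ℝ, 0 < η →
      ∃ (M : ℕ) (γ₁ A : ℝ), 0 < γ₁ ∧ γ₁ ≤ 1 ∧
      ∀ (F : T3Family) (γ : ℝ), F.L = L → 0 < γ → γ ≤ γ₁ →
        ∀ q : Plaq (F.P 0) 0, ∃ (ρ t : ℕ → ℝ) (S : (K : ℕ) → Finset (Plaq (F.P (K + 1)) 0)),
          (∀ K : ℕ, 1 / 2 ≤ t K ∧ t K ≤ 1) ∧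
          (∀ k K : ℕ, k₀ ≤ k → ∑ j ∈ Finset.Ico k K, ρ j ≤ A + η * B10.pFun b₀ p₀ (Real.sqrt γ) ^ 2) ∧
          (∀ K : ℕ, k₀ ≤ K → ((S K).card : ℝ) ≤ ((F.L : ℝ) ^ (K + 1)) ^ M) ∧
          ∀ K : ℕ, k₀ ≤ K →
            (gibbsK F ℰp γ (K + 1)).real ({U | t (K + 1) * θBal F.L γ b₀ p₀ 0 ≤ GaugeGroup.dist1 (GaugeField.plaqHol
                (Averaging.iter (fun i => BlockAveraging.blockAvg (P := F.P (K + 1)) (j := i) ℰp) (K + 1) U)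
                (plaqShift (F.sitesPerDir_unit (K + 1)) q))} ∩
              {U | PlaqSmallOn (↑(S K) : Set (Plaq (F.P (K + 1)) 0)) (θBal F.L γ b' p₀ (K + 1)) U}) ≤
            Real.exp (ρ K) *
            (gibbsK F ℰp γ K).real {U | t K * θBal F.L γ b₀ p₀ 0 ≤ GaugeGroup.dist1 (GaugeField.plaqHol
                (Averaging.iter (fun i => BlockAveraging.blockAvg (P := F.P K) (j := i) ℰp) K U)
                (plaqShift (F.sitesPerDir_unit K) q))}) :
    Summit.QuantumFields.YangMills.Theses.SmallFieldWidening.PlainStabAdd :=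
  plainStabAdd_of_localStepFloor (localStepFloor_of_stepOnlyFrom hS)

/-- ★ **Crux r3 `LargeFieldMassRefinementTail` (stmt-QuantumFields-22884) BY NAME ⇐ `StepOnlyFrom`** (through
`largeFieldMassRefinementTail_of_localStepFloor`): the one-line closer of a reshape of line `birth` to the stub `StepOnlyFrom`.
Conditional certificate; the hypothesis is NOT proved. [cite: Balaban1985UV3, (70)-(71) p.273; Balaban1987RG1, Thm 1 p.259] -/
theorem largeFieldMassRefinementTail_of_stepOnlyFrom
    (hS : ∀ (L : ℕ) (b₀ p₀ : ℝ), 0 < b₀ → 2 < p₀ → ∃ (k₀ : ℕ) (b' : ℝ), 1 ≤ k₀ ∧ 0 < b' ∧ ∀ η : ℝ, 0 < η →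
      ∃ (M : ℕ) (γ₁ A : ℝ), 0 < γ₁ ∧ γ₁ ≤ 1 ∧
      ∀ (F : T3Family) (γ : ℝ), F.L = L → 0 < γ → γ ≤ γ₁ →
        ∀ q : Plaq (F.P 0) 0, ∃ (ρ t : ℕ → ℝ) (S : (K : ℕ) → Finset (Plaq (F.P (K + 1)) 0)),
          (∀ K : ℕ, 1 / 2 ≤ t K ∧ t K ≤ 1) ∧
          (∀ k K : ℕ, k₀ ≤ k → ∑ j ∈ Finset.Ico k K, ρ j ≤ A + η * B10.pFun b₀ p₀ (Real.sqrt γ) ^ 2) ∧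
          (∀ K : ℕ, k₀ ≤ K → ((S K).card : ℝ) ≤ ((F.L : ℝ) ^ (K + 1)) ^ M) ∧
          ∀ K : ℕ, k₀ ≤ K →
            (gibbsK F ℰp γ (K + 1)).real ({U | t (K + 1) * θBal F.L γ b₀ p₀ 0 ≤ GaugeGroup.dist1 (GaugeField.plaqHol
                (Averaging.iter (fun i => BlockAveraging.blockAvg (P := F.P (K + 1)) (j := i) ℰp) (K + 1) U)
                (plaqShift (F.sitesPerDir_unit (K + 1)) q))} ∩
              {U | PlaqSmallOn (↑(S K) : Set (Plaq (F.P (K + 1)) 0)) (θBal F.L γ b' p₀ (K + 1)) U}) ≤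
            Real.exp (ρ K) *
            (gibbsK F ℰp γ K).real {U | t K * θBal F.L γ b₀ p₀ 0 ≤ GaugeGroup.dist1 (GaugeField.plaqHol
                (Averaging.iter (fun i => BlockAveraging.blockAvg (P := F.P K) (j := i) ℰp) K U)
                (plaqShift (F.sitesPerDir_unit K) q))}) :
    Summit.QuantumFields.YangMills.Theses.SmallFieldWidening.LargeFieldMassRefinementTail :=
  largeFieldMassRefinementTail_of_localStepFloor (localStepFloor_of_stepOnlyFrom hS)

end Summit.QuantumFields.YangMills.Theorems.LargeFieldMassRefinementTailStepOnlyFrom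

end
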